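import Mathlib
import Summits.CriticalPhenomena.CardyFormulaZ2.Theses.CardyMagicRigidity
import Literature.Probability.RandomPlanarGeometry.NestingTransform
import Literature.Probability.Percolation.FullPlaneCNL
import HarnessLib

/-!
# Vocabulary of line `ring-cloud-tomography` for crux `NestingRigidity` (stmt-CriticalPhenomena-4835)

Route `CardyMagicRigidity` (sub-problem `CriticalPhenomena/CardyFormulaZ2`), crux
`Summit.CriticalPhenomena.CardyFormulaZ2.Theses.CardyMagicRigidity.NestingRigidity ≡
MagicFormulaZ2 → MagicFormulaT → LoopLimitZ2EqT`.  This file is the **definitions module** of the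
checked skeleton `Cruxes/NestingRigidity/Lines/ring-cloud-tomography.lean` (planner
`planner-cruxplan-stmt-CriticalPhenomena-4835-ring-cloud-tomograph-0`, lead reshape r1 by
`prover-line-stmt-CriticalPhenomena-4835-0`, `ledger skeleton check` OK, 7 registered stubs): it
carries, verbatim and sorry-free, the skeleton's §0 VOCABULARY (mesh-indexed loop ensembles `zEns` /
`tEns`, disc and ring densities, `Cloud`, `Cloud.Admissible`, the explicit energies, tower and
pattern counts, tower moments / pressures, the milestones `TowerStatisticsAgree`,
`NestingStatisticsAgree`) and §1 the seven registered STUB STATEMENTS as named `Prop`s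
(`CloudCalculus` = `CloudAdmissibility` ∧ `CloudEnergy`, `TowerPressureFamily`, `ChargeQuantisation`,
`TowerLaw`, `Fusion`, `Transfer`), so that the stub helper files
`Theorems/CardyMagicRigidityNestingRigidity<StubName>.lean` (each proving `theorem <stubName> :
<Statement>` by name, `--supports stmt-CriticalPhenomena-4835`) and the closing skeleton file share
ONE copy of every object.  Nothing in this file is asserted: every `def … : Prop` is a statement to be
proved (by a registered stub) or a predicate; the three `theorem`s are two membership trivialities and the
glue `cloudCalculus_of : CloudAdmissibility → CloudEnergy → CloudCalculus` (registered sub-goal).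

Objects: see the docstrings (clouds = disc bumps + ring charges in mean-value position, total
charge 0; `towerCount` / `patternCount`; sandwich-form `HasTowerPressure`; `e6` = SSW's CLE₆ exponent).
-/

noncomputable section

open MeasureTheory Set Filter Metric
open scoped Real Topology BigOperators

namespace Summit.CriticalPhenomena.CardyFormulaZ2.Cruxes.NestingRigidity.RingCloudTomography

open Literature.Probability.RandomPlanarGeometry Literature.Probability.Percolation
  Literature.Probability.LatticeModels
open _root_.Summit.CriticalPhenomena.CardyFormulaZ2.Theses.CardyMagicRigidity
  (MagicFormulaZ2 MagicFormulaT LoopLimitZ2EqT NestingRigidity)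

/-! ## §0 Vocabulary -/

/-- A mesh-indexed random full-plane loop ensemble: a probability space and, for every mesh `δ`, a
random typed loop configuration (DKKMO's space `C`). The two instances of the line are `zEns`
(critical bond percolation on `δℤ²`, `bondLoopConfig δ 0`) and `tEns` (critical site percolation on
`δ𝕋`, `siteLoopConfig δ`). -/
structure LoopEnsemble where
  /-- sample space -/
  Ω : Type
  /-- its σ-algebra -/
  [mΩ : MeasurableSpace Ω]
  /-- the percolation measure -/
  P : Measure Ω
  /-- the typed loop configuration at mesh `δ` -/
  X : ℝ → Ω → LoopConfig ℂ

attribute [instance] LoopEnsemble.mΩ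

/-- Critical bond percolation on `δℤ²` with DKKMO's typed loop representation. -/
def zEns : LoopEnsemble where
  Ω := BondConfig (Site 2)
  P := bondPercolation (zdGraph 2) half
  X := fun δ ↦ bondLoopConfig δ 0

/-- Critical site percolation on `δ𝕋` with the typed honeycomb interface loops (`siteLoopConfig`,
definitionally the configuration written inline in the route items, `siteLoopConfig_eq`). -/
def tEns : LoopEnsemble where
  Ω := SiteConfig (Site 2)
  P := triSitePercolation half
  X := siteLoopConfig

/-- The two lattice ensembles of the crux. -/
def latticeEnsembles : Set LoopEnsemble := {zEns, tEns}

/-- `zEns` is one of the two lattice ensembles. -/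
theorem zEns_mem : zEns ∈ latticeEnsembles := Set.mem_insert _ _

/-- `tEns` is one of the two lattice ensembles. -/
theorem tEns_mem : tEns ∈ latticeEnsembles := Set.mem_insert_of_mem _ (Set.mem_singleton _)

/-- The magic formula for an ensemble, in the route's quantifier shape: for every bounded measurable
compactly supported density `f` with `∫ f = 0`, `E[A_f(X_δ)] → exp((3/4π²) ∬ log‖x−y‖ f f)` as
`δ → 0⁺` (`LoopConfig.nestingWeight f` is literally the route's `∏ᶠ` functional,
`nestingWeight_eq_finprod`). `MagicFormulaZ2` is `zEns.HasMagicTransform` (`rfl`) and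
`MagicFormulaT` is `tEns.HasMagicTransform` (`hasMagicTransform_tEns`). -/
def LoopEnsemble.HasMagicTransform (E : LoopEnsemble) : Prop :=
  ∀ (f : ℂ → ℝ) (R C : ℝ), Measurable f → (∀ z, |f z| ≤ C) → (∀ z, R < ‖z‖ → f z = 0) →
    ∫ z, f z = 0 →
      Tendsto (fun δ : ℝ ↦ ∫ ω, (E.X δ ω).nestingWeight f ∂E.P) (𝓝[>] 0)
        (𝓝 (Real.exp (3 / (4 * π ^ 2) * ∫ x, ∫ y, Real.log ‖x - y‖ * f x * f y)))

/-! ### Clouds: disc bumps and ring (annulus) charges -/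

/-- Uniform probability density on the open disc `B(x, r)`. -/
def discDensity (x : ℂ) (r : ℝ) : ℂ → ℝ := (ball x r).indicator fun _ ↦ (π * r ^ 2)⁻¹

/-- Uniform probability density on the annulus `L ≤ ‖z − c‖ < M` (a "ring charge"). -/
def annulusDensity (c : ℂ) (L M : ℝ) : ℂ → ℝ :=
  {z : ℂ | L ≤ ‖z - c‖ ∧ ‖z - c‖ < M}.indicator fun _ ↦ (π * (M ^ 2 - L ^ 2))⁻¹

/-- A CLOUD: `m` disc bumps (centre `x i`, radius `r i`, charge `a i`) and `n` rings (centre `c k`,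
radii `L k < M k`, charge `g k`). -/
structure Cloud where
  /-- number of disc bumps -/
  m : ℕ
  /-- number of rings -/
  n : ℕ
  /-- bump centres -/
  x : Fin m → ℂ
  /-- bump radii -/
  r : Fin m → ℝ
  /-- bump charges -/
  a : Fin m → ℝ
  /-- ring centres -/
  c : Fin n → ℂ
  /-- ring inner radii -/
  L : Fin n → ℝ
  /-- ring outer radii -/
  M : Fin n → ℝ
  /-- ring charges -/
  g : Fin n → ℝ

/-- The test density of a cloud: `f = Σ_i a_i ρ_{x_i,r_i} + Σ_k g_k σ_{c_k,L_k,M_k}`. -/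
def Cloud.density (𝔠 : Cloud) (z : ℂ) : ℝ :=
  ∑ i, 𝔠.a i * discDensity (𝔠.x i) (𝔠.r i) z + ∑ k, 𝔠.g k * annulusDensity (𝔠.c k) (𝔠.L k) (𝔠.M k) z

/-- ADMISSIBLE clouds: positive radii, total charge zero, and every pair of carriers in MEAN-VALUE
POSITION — discs pairwise disjoint; a disc either inside a ring's hole or outside its outer circle;
two rings either nested (one inside the other's hole) or mutually outside. Exactly the geometry in
which the logarithmic cross energies are explicit (`Cloud.energy`). -/
structure Cloud.Admissible (𝔠 : Cloud) : Prop where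
  /-- disc radii are positive -/
  r_pos : ∀ i, 0 < 𝔠.r i
  /-- inner ring radii are positive -/
  L_pos : ∀ k, 0 < 𝔠.L k
  /-- rings have positive width -/
  L_lt_M : ∀ k, 𝔠.L k < 𝔠.M k
  /-- total charge zero -/
  neutral : ∑ i, 𝔠.a i + ∑ k, 𝔠.g k = 0
  /-- discs pairwise disjoint (tangency allowed) -/
  disc_disc : ∀ i j, i ≠ j → 𝔠.r i + 𝔠.r j ≤ ‖𝔠.x i - 𝔠.x j‖
  /-- each disc lies in a ring's hole or outside its outer circle -/
  disc_ring : ∀ i k, ‖𝔠.x i - 𝔠.c k‖ + 𝔠.r i ≤ 𝔠.L k ∨ 𝔠.M k + 𝔠.r i ≤ ‖𝔠.x i - 𝔠.c k‖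
  /-- two rings are nested (one in the other's hole) or mutually exterior -/
  ring_ring : ∀ k l, k ≠ l →
    ‖𝔠.c k - 𝔠.c l‖ + 𝔠.M k ≤ 𝔠.L l ∨ ‖𝔠.c l - 𝔠.c k‖ + 𝔠.M l ≤ 𝔠.L k ∨
      𝔠.M k + 𝔠.M l ≤ ‖𝔠.c k - 𝔠.c l‖

/-- Self-energy `∬ log‖x−y‖ ρ ρ` of the uniform probability density on a disc of radius `r`:
`log r − 1/4`. -/
def discSelfEnergy (r : ℝ) : ℝ := Real.log r - 1 / 4

/-- Mean logarithmic potential of the ring `σ_{c,L,M}` at ANY point of its hole `‖z − c‖ ≤ L`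
(mean-value property of `log`): `(M² log M − L² log L)/(M² − L²) − 1/2`. This constancy is the lever
of the line: a ring interacts with every charge inside it through (charge) × (this constant). -/
def ringHolePotential (L M : ℝ) : ℝ :=
  (M ^ 2 * Real.log M - L ^ 2 * Real.log L) / (M ^ 2 - L ^ 2) - 1 / 2

/-- Self-energy `∬ log‖x−y‖ σ σ` of the ring `σ_{c,L,M}` (radial computation; `→ log M − 1/4` as
`L → 0`). -/
def ringSelfEnergy (L M : ℝ) : ℝ :=
  (M ^ 4 * Real.log M - 2 * L ^ 2 * M ^ 2 * Real.log M + L ^ 4 * Real.log L + L ^ 2 * M ^ 2 -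
      (3 * L ^ 4 + M ^ 4) / 4) / (M ^ 2 - L ^ 2) ^ 2

/-- THE EXPLICIT GAUSSIAN EXPONENT OF A CLOUD, `Q(f) = ∬ log‖x−y‖ f(x) f(y) dx dy` for
`f = 𝔠.density`, `𝔠` admissible: disc–disc `log‖x_i − x_j‖`, disc self `log r − 1/4`, disc in a
ring's hole `ringHolePotential` (position-free!), disc outside a ring `log‖x_i − c_k‖`, nested rings
`ringHolePotential` of the outer one, rings mutually outside `log‖c_k − c_l‖`, ring self
`ringSelfEnergy`. Verified by quadrature/Monte Carlo to 1e-12 / 3 s.d. (planner NOTES.md). -/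
def Cloud.energy (𝔠 : Cloud) : ℝ :=
  (∑ i, ∑ j, 𝔠.a i * 𝔠.a j *
      (if i = j then discSelfEnergy (𝔠.r i) else Real.log ‖𝔠.x i - 𝔠.x j‖)) +
  (2 * ∑ i, ∑ k, 𝔠.a i * 𝔠.g k *
      (if ‖𝔠.x i - 𝔠.c k‖ + 𝔠.r i ≤ 𝔠.L k then ringHolePotential (𝔠.L k) (𝔠.M k)
        else Real.log ‖𝔠.x i - 𝔠.c k‖)) +
  ∑ k, ∑ l, 𝔠.g k * 𝔠.g l *
      (if k = l then ringSelfEnergy (𝔠.L k) (𝔠.M k)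
        else if ‖𝔠.c k - 𝔠.c l‖ + 𝔠.M k ≤ 𝔠.L l then ringHolePotential (𝔠.L l) (𝔠.M l)
        else if ‖𝔠.c l - 𝔠.c k‖ + 𝔠.M l ≤ 𝔠.L k then ringHolePotential (𝔠.L k) (𝔠.M k)
        else Real.log ‖𝔠.c k - 𝔠.c l‖)

/-- The CLOUD LAW of an ensemble: the transform of every admissible cloud converges to the explicit
Gaussian value `exp((3/4π²) · 𝔠.energy)` — an exact product of pure powers of the radii, one
exponential per scale band (ring-cloud tomography input). -/
def LoopEnsemble.CloudLaw (E : LoopEnsemble) : Prop :=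
  ∀ 𝔠 : Cloud, 𝔠.Admissible →
    Tendsto (fun δ : ℝ ↦ ∫ ω, (E.X δ ω).nestingWeight 𝔠.density ∂E.P) (𝓝[>] 0)
      (𝓝 (Real.exp (3 / (4 * π ^ 2) * 𝔠.energy)))

/-! ### Tower and pattern counts -/

/-- TOWER COUNT `N_x(ρ, R)`: the number of loops (both types) of the configuration `c` whose interior
`{W ≠ 0}` contains the closed disc `B̄(x, ρ)` and whose trace lies in the open window `B(x, R)`.
By NON-CROSSING these loops form a chain (the tower above `x`); `Set.ncard`, finite for every lattice
configuration. -/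
def towerCount (c : LoopConfig ℂ) (x : ℂ) (ρ R : ℝ) : ℕ :=
  Set.ncard {u ∈ c.loops | closedBall x ρ ⊆ {z | u.wind z ≠ 0} ∧ u.range ⊆ ball x R}

/-- PATTERN COUNT `N_S` of a finite disc family `B̄(z i, r i)`, `i : Fin n`, in the window
`B(0, R)`: the number of loops inside the window that SURROUND exactly the discs indexed by `S`
(interior contains them) and AVOID the others (closed disc in the exterior, off the trace). The joint
law of `(N_S)_{∅ ≠ S ⊆ [n]}` over all finite disc families is the nesting-tree statistics of the
ensemble. -/
def patternCount (c : LoopConfig ℂ) {n : ℕ} (z : Fin n → ℂ) (r : Fin n → ℝ) (R : ℝ)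
    (S : Finset (Fin n)) : ℕ :=
  Set.ncard {u ∈ c.loops | u.range ⊆ ball (0 : ℂ) R ∧
    (∀ i ∈ S, closedBall (z i) (r i) ⊆ {w | u.wind w ≠ 0}) ∧
    ∀ i, i ∉ S → Disjoint (closedBall (z i) (r i)) ({w | u.wind w ≠ 0} ∪ u.range)}

/-- The positively weighted one-point tower moment `E_δ[u^{N_0(ρ,1)}]` of an ensemble at mesh `δ`
(`u ≥ 0`; at `u = 0` this is `P_δ[N_0(ρ,1) = 0]`, a polychromatic one-arm probability). -/
def LoopEnsemble.towerMoment (E : LoopEnsemble) (u δ ρ : ℝ) : ℝ :=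
  ∫ ω, u ^ towerCount (E.X δ ω) 0 ρ 1 ∂E.P

/-- TOWER PRESSURE `e(u)` on a set of weights `S`, in honest sandwich form (no scaling limit of the
moments is presupposed): for every `u ∈ S` and `ε > 0`, for all small `ρ` and then all small meshes,
`ρ^{e(u)+ε} ≤ E_δ[u^{N_0(ρ,1)}] ≤ ρ^{e(u)−ε}`. -/
def LoopEnsemble.HasTowerPressure (E : LoopEnsemble) (e : ℝ → ℝ) (S : Set ℝ) : Prop :=
  ∀ u ∈ S, ∀ ε : ℝ, 0 < ε →
    ∀ᶠ ρ in 𝓝[>] (0 : ℝ), ∀ᶠ δ in 𝓝[>] (0 : ℝ),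
      ρ ^ (e u + ε) ≤ E.towerMoment u δ ρ ∧ E.towerMoment u δ ρ ≤ ρ ^ (e u - ε)

/-- The one-parameter family of pressures that ring tomography leaves open before quantisation:
`e_a(u) = β(arccos(u/2) − π/3)² + a(arccos(u/2) − π/3)`, `β = 3/4π²`; `a = √3 ×` nesting density. -/
def pressureFamily (a u : ℝ) : ℝ :=
  3 / (4 * π ^ 2) * (Real.arccos (u / 2) - π / 3) ^ 2 + a * (Real.arccos (u / 2) - π / 3)

/-- Schramm–Sheffield–Wilson's CLE₆ one-point nesting exponent in the weight variable,
`e₆(u) = (3/4)((arccos(u/2)/π)² − 1/9)` (`= pressureFamily (1/2π) u`; `e₆(0) = 5/48`, `e₆(1) = 0`,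
`e₆(√3) = −1/16`, `e₆(2) = −1/12`). [arXiv:math/0611687, Thm 1] -/
def e6 (u : ℝ) : ℝ := 3 / 4 * ((Real.arccos (u / 2) / π) ^ 2 - 1 / 9)

/-- ONE-POINT TOWER STATISTICS AGREE: for every centre, window and finite set of inner radii, the
joint law of the tower counts under bond-`ℤ²` and under site-`𝕋` differ by `o(1)` as `δ → 0⁺`. -/
def TowerStatisticsAgree : Prop :=
  ∀ (x : ℂ) (m : ℕ) (ρ : Fin m → ℝ) (R : ℝ) (k : Fin m → ℕ), (∀ j, 0 < ρ j) → (∀ j, ρ j < R) →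
    Tendsto (fun δ : ℝ ↦
      (zEns.P {ω | ∀ j, towerCount (zEns.X δ ω) x (ρ j) R = k j}).toReal -
        (tEns.P {ω | ∀ j, towerCount (tEns.X δ ω) x (ρ j) R = k j}).toReal) (𝓝[>] 0) (𝓝 0)

/-- NESTING-TREE STATISTICS AGREE: for every finite family of pairwise disjoint closed discs and
every window, the joint law of the pattern counts `(N_S)_{S ≠ ∅}` under bond-`ℤ²` and under site-`𝕋`
differ by `o(1)` as `δ → 0⁺`. -/
def NestingStatisticsAgree : Prop :=
  ∀ (n : ℕ) (z : Fin n → ℂ) (r : Fin n → ℝ) (R : ℝ) (k : Finset (Fin n) → ℕ), (∀ i, 0 < r i) →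
    (∀ i j, i ≠ j → r i + r j < ‖z i - z j‖) →
    Tendsto (fun δ : ℝ ↦
      (zEns.P {ω | ∀ S : Finset (Fin n), S.Nonempty → patternCount (zEns.X δ ω) z r R S = k S}).toReal -
        (tEns.P {ω | ∀ S : Finset (Fin n), S.Nonempty →
          patternCount (tEns.X δ ω) z r R S = k S}).toReal) (𝓝[>] 0) (𝓝 0)

/-! ## §1 The six stub statements -/

/-- **S1 · CloudCalculus** (potential theory of the test functions; provable now, size M). Every
admissible cloud density is a route-admissible test function (measurable, bounded, supported in a
ball, mean zero) AND its logarithmic energy `∬ log‖x−y‖ f f` equals the explicit `Cloud.energy`.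
Content: `∫ discDensity = ∫ annulusDensity = 1` (`Complex.volume_ball`), Fubini for the log kernel
against bounded compactly supported densities, and the two mean-value facts — the circle average of
`log‖x − ·‖` is `log max(‖x − c‖, s)` (Mathlib `circleAverage_log_norm_sub_const_eq_log_radius_add_posLog`),
whence the disc average of a function harmonic on the disc is its central value and the ring average
of `log‖x − ·‖` is `ringHolePotential L M` for every `x` in the hole.  (Lead reshape, 2026-08-16: S1
is registered as the conjunction of the two stubs `CloudAdmissibility` (S1a) and `CloudEnergy` (S1b)
below, `cloudCalculus_of`; the statement `CloudCalculus` itself is unchanged.) -/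
def CloudCalculus : Prop :=
  ∀ 𝔠 : Cloud, 𝔠.Admissible →
    Measurable 𝔠.density ∧ (∃ C : ℝ, ∀ z, |𝔠.density z| ≤ C) ∧
      (∃ R : ℝ, ∀ z, R < ‖z‖ → 𝔠.density z = 0) ∧ ∫ z, 𝔠.density z = 0 ∧
        ∫ x, ∫ y, Real.log ‖x - y‖ * 𝔠.density x * 𝔠.density y = 𝔠.energy

/-- **S1a · CloudAdmissibility** (size S–M, provable now): the density of an admissible cloud is a
route-admissible test function — measurable (finite sum of scaled indicators of a ball / an annulus),
bounded, supported in a ball (finitely many bounded carriers), and of mean zero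
(`∫ discDensity = ∫ annulusDensity = 1`, `Complex.volume_ball`, and `Cloud.Admissible.neutral`). -/
def CloudAdmissibility : Prop :=
  ∀ 𝔠 : Cloud, 𝔠.Admissible →
    Measurable 𝔠.density ∧ (∃ C : ℝ, ∀ z, |𝔠.density z| ≤ C) ∧
      (∃ R : ℝ, ∀ z, R < ‖z‖ → 𝔠.density z = 0) ∧ ∫ z, 𝔠.density z = 0

/-- **S1b · CloudEnergy** (size M–L, provable now): the logarithmic energy of an admissible cloud is
the explicit `Cloud.energy` — bilinear expansion of `∬ log‖x−y‖ f(x) f(y)` over the carriers (Fubini: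
the log kernel is locally integrable in the plane and the densities are bounded with compact support),
then the seven pair energies: disc–disc `log‖xᵢ − xⱼ‖` and disc/ring outside a ring `log‖centre −
centre‖` (mean-value property of the harmonic function `log‖· − p‖` on a disc not containing `p`, in
area form), disc self `log r − 1/4`, disc or ring inside a ring's hole `ringHolePotential` (the circle
average of `log‖x − ·‖` over `|y − c| = s` is `log max(‖x − c‖, s)`:
`circleAverage_log_norm_sub_const_eq_log_radius_add_posLog`, integrated radially with
`∫ s log s = s² log s /2 − s²/4`), ring self `ringSelfEnergy` (same radial computation). -/
def CloudEnergy : Prop :=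
  ∀ 𝔠 : Cloud, 𝔠.Admissible →
    ∫ x, ∫ y, Real.log ‖x - y‖ * 𝔠.density x * 𝔠.density y = 𝔠.energy

/-- S1 is the conjunction of its two registered halves S1a and S1b (registered sub-goal
`cloudCalculus_of`, the anchor of this definitions module on the crux item). -/
theorem cloudCalculus_of : CloudAdmissibility → CloudEnergy → CloudCalculus :=
  fun ha he 𝔠 h𝔠 ↦
    ⟨(ha 𝔠 h𝔠).1, (ha 𝔠 h𝔠).2.1, (ha 𝔠 h𝔠).2.2.1, (ha 𝔠 h𝔠).2.2.2, he 𝔠 h𝔠⟩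

/-- **S2 · TowerPressureFamily** (ring tomography in the fully positive regime; size L). For each
of the two lattice ensembles, the cloud law forces the positively weighted one-point tower moments
to have EXACT power-law exponents `e_a(u) = β(arccos(u/2) − π/3)² + a(arccos(u/2) − π/3)` on the
whole weight range `u ∈ [0, √3]`, for one constant `a` (= `√3 ×` the nesting density of the
ensemble). Mechanism: one bump of charge `α` inside rings of charges `γ_k` with total positive charge
`≤ π/6` ⇒ EVERY loop weight and UV factor is positive (triage F1/F7), the band between ring `k` and
ring `k+1` carries weight `u_k = w(Λ_k)`, `Λ_k = α + γ_1 + ⋯ + γ_k ∈ [−π/6, π/6]`, and the cloud law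
attaches the exponent `βΛ_k²` to the band width EXACTLY; quasi-multiplicativity of positively weighted
tower functionals and RSW decoupling of the scale-localised UV / ring-crossing factors (both lattices
have the RSW/arm technology) identify the band's exponential rate with `e(u_k) − aΛ_k`, the drift
`aΛ_k` coming from the microscopic loops inside the charge carriers (`δ` cancels by neutrality).
No analyticity, no signed weights. -/
def TowerPressureFamily : Prop :=
  ∀ E ∈ latticeEnsembles, E.CloudLaw →
    ∃ a : ℝ, E.HasTowerPressure (pressureFamily a) (Icc 0 (Real.sqrt 3))

/-- **S3 · ChargeQuantisation** (the background charge is `a = 1/2π`; size L; the one genuinely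
delicate analytic step of the `n = 1` layer, shared with cards `pressure-branch-point` and
`positive-cone-weight-doubling`). Given the family law of S2, `a = 1/2π`, i.e. the exponents ARE
Schramm–Sheffield–Wilson's `e₆` on `[0, √3]` (one-arm `e₆(0) = 5/48` included). Devices on offer:
(i) the two admissible band charges `Λ`, `Λ' = −2π/3 − Λ` with the same weight `w(Λ) = w(Λ')` give
two rates `βΛ² + aΛ`, `βΛ'² + aΛ'` whose difference is `(Λ' − Λ)(a − 1/2π)` — realising `Λ' < −π/3`
needs signed ring-crossing factors (top-rate visibility of signed boundary states: `a > 1/2π` is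
excluded outright, `a < 1/2π` needs a non-vanishing overlap); (ii) concavity of the pressure in
`log u` + its existence on a neighbourhood of the branch point `u = 2` of `arccos(u/2)` (triage r1-3
(a)); (iii) analytic perturbation theory of the positively tilted interface-Markov tower (spectral
gap from RSW-Doeblin mixing of nested shapes). -/
def ChargeQuantisation : Prop :=
  ∀ E ∈ latticeEnsembles, E.CloudLaw →
    (∃ a : ℝ, E.HasTowerPressure (pressureFamily a) (Icc 0 (Real.sqrt 3))) →
      E.HasTowerPressure e6 (Icc 0 (Real.sqrt 3))

/-- **S4 · TowerLaw** (from pressures to LAWS — the hardest stub, size XL; this is where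
non-crossing is used). With both cloud laws and both pressures `= e₆` in hand, the one-point tower
count laws of bond-`ℤ²` and site-`𝕋` agree asymptotically. Intended proof: (a) NON-CROSSING ⇒ the
loops around a point form a chain; (b) the lattice INTERFACE-MARKOV property (an interface is a
cylinder event on its own edges/hexagons; inside and outside are conditionally independent — exact on
both lattices) ⇒ the chain is a Markov renewal tower in log-scale with state = rescaled shape (+ type),
RSW-Doeblin mixing; the barrier's `CLE₃ ⊔ CLE₃` impostor (`superposition_half_variance`,
`sswMGF_three_eq_six`) is a superposition of two towers and fails (b) although it passes every cloud
identity; (c) ELECTRIC RANK ONE: the cloud law gives `⟨ring| T_u(t) |ring'⟩ = C e^{−e₆(u)t}` with NO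
subleading exponential for every band width `t` and every admissible pair of ring states, so the
tilted transfer semigroup is rank one on the closed span of ring states; (d) for a rank-one
(shape-forgetting) renewal tower the pressure equation is `u · E[e^{e₆(u)B}] = 1`, so the Laplace
transform of the log-scale decrement `B` is known on the interval `e₆((0,√3]) = [−1/16, 5/48)` (`5/48` = SSW's abscissa), hence
the law of `B` (Laplace uniqueness) and with it every finite-dimensional tower-count law in a window;
(e) the same on `𝕋` ⇒ equality. Why it might fail: DARK MODES — tower modes invisible to all ring
states (then (c) does not give rank one of the full kernel); the bet is "local electric completeness"
(span of ring/bump functionals dense in L² of the local configuration law), to be derived from the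
interface-Markov decoupling, not assumed. -/
def TowerLaw : Prop :=
  zEns.CloudLaw → tEns.CloudLaw →
    zEns.HasTowerPressure e6 (Icc 0 (Real.sqrt 3)) → tEns.HasTowerPressure e6 (Icc 0 (Real.sqrt 3)) →
      TowerStatisticsAgree

/-- **S5 · Fusion** (layers `n ≥ 2`; size XL). Given both cloud laws and the one-point tower laws,
ALL finite disc-pattern count laws agree. Intended proof, by induction on the number of discs: a
NON-neutral pair of bumps (charges `α`, `β'`) neutralised by rings puts the INDEPENDENT weights
`w(α)`, `w(β')` on the two sub-towers (off the "ellipse arc" of the crux's why-might-fail; all weights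
positive iff `|α|, |β'|, |α + β'| ≤ π/6`, triage r1-3 — an open set); the limit is blind to the pair's
position inside the rings (`ChargedPairPositionIndependence`, exact); a ring hugging the pair at
radius `(1+η)d` squeezes the one tied band (loops around both bumps below the first ring) to
probability `1 − O(η^c)` (two 2-arm events); FUSION RATIOS against the single-bump identity under the
same cloud cancel every ring self-energy, ring–ring energy and ring-crossing amplitude (rank one, S4), isolating
the pair's entrance amplitude — a two-variable Laplace-type transform of the joint law of the two
sub-towers' entrance scales and the separation event, known on an open set, hence unique; nested
clouds iterate. Why it might fail: the deconvolution in the squeezed band may lose uniqueness if the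
separation amplitudes are not in the electric span (same dark-mode caveat as S4, now for two-point
states). -/
def Fusion : Prop :=
  zEns.CloudLaw → tEns.CloudLaw → TowerStatisticsAgree → NestingStatisticsAgree

/-- **S6 · Transfer** (nesting-tree statistics ⇒ `d_CN`; magic-free lattice topology, size L).
Equality of all finite pattern-count statistics forces `d_CN(bond-ℤ²_δ, site-𝕋_δ) → 0`. Intended
proof: tightness of both lattice families (Aizenman–Burchard regularity from RSW on `ℤ²` and on `𝕋`;
tight numbers of macroscopic loops per window; dense microscopic loops of both types at scales `≪ ε`,
needed by the soft window of `IsClose`); along any jointly convergent subsequence the two limits have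
the same nesting-tree law, and a locally finite NON-CROSSING configuration of loops of COVERING DEGREE
ONE (`W ∈ {0, ±1}`, exterior boundaries of clusters; no triple points since the polychromatic 6-arm
exponent exceeds 2 on both lattices) is a measurable, `d_CN`-a.e.-continuous function of the family
of base discs each loop surrounds (loop = boundary of its interior); TYPES come from the lattice, not
from statistics: they alternate along the nesting tree and the one global bit is fair and
asymptotically independent (colour flip on `𝕋`; self-duality of bond-`ℤ²` at `1/2` up to a `δ/2`
shift) — exactly the evasions listed by barrier `NestingTransformBlindness` (whose configuration-level
witnesses — type swap, point loop, double circle — show that none of these three inputs can be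
dropped). -/
def Transfer : Prop :=
  NestingStatisticsAgree → LoopLimitZ2EqT


end Summit.CriticalPhenomena.CardyFormulaZ2.Cruxes.NestingRigidity.RingCloudTomography

end
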